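import Summits.CriticalPhenomena.Ising3D.TaylorTableIdentityCLeaf
import Summits.CriticalPhenomena.Ising3D.TaylorTableOddHeadDeltaMergedCells
import Mathlib.Tactic.Linarith
import Mathlib.Tactic.Positivity
import Mathlib.Tactic.Ring
import HarnessLib

/-!
# The table theorem with the CENTRED-FORM identity check (T6 piece (vi)): `checkSC`, `boxExcluded_of_taylorTable_headsC`
(cell `pub-ising3x`, seat boot-1 gen 17; HOME/pub-ising3x-boot-1/b3spine-g17/IDENTITY-B3.md)

HONEST FRAMING: lottery ticket; floor = tightest certified 3D Ising CFT bounds; no exact-solution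
claim without a proof. Island framing: certified exclusion region at stated derivative order and
assumptions; not a determination of the 3D Ising critical exponents beyond that.

`TaylorTable.checkIdentity` / `checkS` hard-wire the natural-interval leaf check of the identity kd-certificate and
`boxExcluded_of_taylorTable_heads` discharges obligation (I) with `identity_pos_of_kdCheck`. For slaved-Ψ tables (BOX 3 on)
the identity q-sums cancel ≈ 5 000 : 1 and that check needs O(10³) leaves; the centred-form leaf check `identityLeafC`
(TaylorTableIdentityCLeaf) needs one. This file: (1) `boxExcluded_of_taylorTable_heads_of_identityPos` — the table theorem with
the identity positivity as a PROP hypothesis (proof = `boxExcluded_of_taylorTable_heads` verbatim with that one line abstracted);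
(2) `checkIdentityC` / `checkSC` / `checkSC_of_conjuncts` — the structural check with the centred leaf check; (3)
`boxExcluded_of_taylorTable_headsC` — the table theorem from `checkSC`. The old route is untouched. [folklore]
-/

namespace Summit.CriticalPhenomena.Ising3D

open Finset Set
open Literature.MathematicalPhysics.QuantumFieldTheory.ConformalBootstrap3D
open Literature.Analysis.ValidatedNumerics Literature.Analysis.ValidatedNumerics.PolyMP
open Literature.Analysis.ValidatedNumerics.NumericsMP

namespace TaylorTable

variable (T : TaylorTable)

/-- **THE TABLE THEOREM (g2) with the identity obligation as a hypothesis**: structural checks (basic, κ-enclosure,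
per-cell structure, both covers) + both head layers + the even region field + the odd cone + `0 < identityTerm` on the box
⇒ the box is excluded. (`boxExcluded_of_taylorTable_heads` with its identity line abstracted.) [cite: KosPolandSimmonsduffin2014, §3.3 eq. (3.16)] -/
theorem boxExcluded_of_taylorTable_heads_of_identityPos (hB : T.checkBasic = true)
    (hIpos : ∀ p ∈ Icc (T.σlo : ℝ) T.σhi ×ˢ Icc (T.εlo : ℝ) T.εhi,
      0 < (taylorCrossing (1 / 2) (1 / 2) T.L.toFinset (fun i ab => (T.c i ab : ℝ))).identityTerm p.1 p.2)
    (hEcells : T.evenCells.all T.checkEvenCellS = true) (hEcov : T.checkEvenCover = true)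
    (hOcells : T.oddCells.all T.checkOddCellS = true) (hOcov : T.checkOddCover = true)
    (hEH : T.EvenHeads) (hOH : T.OddHeads)
    (hR : TaylorEvenRegion T.α T.box ((T.E₀ : ℚ) : ℝ)) (hC : T.OddCone) : BoxExcluded T.box := by
  simp only [checkBasic, Bool.and_eq_true, decide_eq_true_eq] at hB
  obtain ⟨⟨⟨⟨⟨⟨⟨⟨hL, hLψ⟩, hκ₀⟩, hσlo⟩, hσhi⟩, hgap⟩, hE₀⟩, hLE⟩, hLT⟩ := hB
  rw [List.all_eq_true] at hEcells hOcells
  have hQ : ∀ p ∈ T.box, 1 / 2 < p.1 ∧ p.1 < 1 ∧ p.1 + 1 / 2 < p.2 := by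
    intro p hp
    obtain ⟨⟨h1, h2⟩, ⟨h3, _⟩⟩ := hp
    have e1 : ((1 / 2 : ℚ) : ℝ) < (T.σlo : ℝ) := by exact_mod_cast hσlo
    have e2 : (T.σhi : ℝ) < ((1 : ℚ) : ℝ) := by exact_mod_cast hσhi
    have e3 : ((T.σhi + 1 / 2 : ℚ) : ℝ) < (T.εlo : ℝ) := by exact_mod_cast hgap
    push_cast at e1 e2 e3
    exact ⟨by linarith, by linarith, by linarith⟩
  have hE₀' : (1 / 2 : ℝ) < ((T.E₀ : ℚ) : ℝ) := by
    have h : ((1 / 2 : ℚ) : ℝ) < ((T.E₀ : ℚ) : ℝ) := by exact_mod_cast hE₀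
    push_cast at h
    exact h
  refine boxExcluded_of_taylorConeObligations_half T.L.toFinset (fun k ab => (T.c k ab : ℝ)) T.Lψ.toFinset
    (fun ab => (T.ψ ab : ℝ)) (κ₀ := (T.κ₀ : ℝ)) (by exact_mod_cast hκ₀) (E₀ := ((T.E₀ : ℚ) : ℝ))
    (E_T := ((T.E_T : ℚ) : ℝ)) hE₀' hQ ?_
  refine TaylorConeObligations.of_oddCover ?hI ?hEc ?hEr
    (T.oddCells.map fun C => ⟨C.ℓ, C.lo, C.hi, C.F.toFinset⟩) ?hOcov ?hOhead ?hOF hC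
  -- (I) identity
  · exact hIpos
  -- (E) even cells from the cover
  · refine evenCellField_of_cover _ T.box _ (T.evenCells.map fun C => ⟨C.ℓ, C.lo, C.hi, C.F.toFinset⟩)
      ?_ ?_ ?_ hR
    · -- cover
      rw [checkEvenCover, Bool.and_eq_true, Bool.and_eq_true, List.any_eq_true, List.all_eq_true] at hEcov
      obtain ⟨⟨⟨Cε, hCε, hCε'⟩, h3⟩, hℓ⟩ := hEcov
      rw [Bool.and_eq_true, Bool.and_eq_true, decide_eq_true_iff, decide_eq_true_iff, decide_eq_true_iff] at hCε'
      obtain ⟨⟨hCε0, hCεlo⟩, hCεhi⟩ := hCε'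
      refine evenCover_of_perSpin T.box _ _ T.LE (by exact_mod_cast hLE) ?_ ?_ ?_
      · intro p hp
        refine ⟨⟨Cε.ℓ, Cε.lo, Cε.hi, Cε.F.toFinset⟩, List.mem_map.mpr ⟨Cε, hCε, rfl⟩, hCε0, ?_, ?_⟩
        · exact le_trans (by exact_mod_cast hCεlo : ((Cε.lo : ℚ) : ℝ) ≤ (T.εlo : ℝ)) hp.2.1
        · exact le_trans hp.2.2 (by exact_mod_cast hCεhi : (T.εhi : ℝ) ≤ ((Cε.hi : ℚ) : ℝ))
      · intro Δ h3Δ hΔE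
        obtain ⟨I, hI, h1, h2⟩ := chainCovers_sound _ _ _ h3 Δ (by exact_mod_cast h3Δ) hΔE.le
        obtain ⟨C, hC, hCℓ, rfl⟩ := T.exists_evenCell_of_mem_ivls hI
        exact ⟨⟨C.ℓ, C.lo, C.hi, C.F.toFinset⟩, List.mem_map.mpr ⟨C, hC, rfl⟩, hCℓ, h1, h2⟩
      · intro ℓ hev h1ℓ hℓL Δ hbΔ hΔE
        have hch : chainCovers ((ℓ : ℚ) + 1) T.E₀ (T.evenIvls ℓ) = true := by
          have h := hℓ ℓ (List.mem_range.mpr hℓL)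
          rw [Bool.or_eq_true, Bool.or_eq_true, decide_eq_true_iff, Bool.not_eq_true', decide_eq_false_iff_not] at h
          rcases h with (h | h) | h
          · omega
          · exact absurd hev h
          · exact h
        obtain ⟨I, hI, h1, h2⟩ := chainCovers_sound _ _ _ hch Δ (by push_cast; exact hbΔ) hΔE.le
        obtain ⟨C, hC, hCℓ, rfl⟩ := T.exists_evenCell_of_mem_ivls hI
        exact ⟨⟨C.ℓ, C.lo, C.hi, C.F.toFinset⟩, List.mem_map.mpr ⟨C, hC, rfl⟩, hCℓ, h1, h2⟩
    · -- heads: the hypothesis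
      intro c hc p hp Δ ha hb _ _ _ a b
      obtain ⟨C, hC, rfl⟩ := List.mem_map.mp hc
      exact hEH C hC p hp Δ ha hb a b
    · -- off the head set
      intro c hc q hq hr
      obtain ⟨C, hC, rfl⟩ := List.mem_map.mp hc
      have hcell := hEcells C hC
      simp only [checkEvenCellS, Bool.and_eq_true, decide_eq_true_eq, List.all_eq_true] at hcell
      obtain ⟨⟨⟨_, _⟩, _⟩, hcanon⟩ := hcell
      exact offHead_of_canonOK hcanon q hq hr
  -- (E5) even region
  · exact hR
  -- odd cover
  · rw [checkOddCover, Bool.and_eq_true, Bool.and_eq_true, List.any_eq_true, List.all_eq_true] at hOcov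
    obtain ⟨⟨⟨Cσ, hCσ, hCσ'⟩, h3⟩, hℓ⟩ := hOcov
    rw [Bool.and_eq_true, Bool.and_eq_true, decide_eq_true_iff, decide_eq_true_iff, decide_eq_true_iff] at hCσ'
    obtain ⟨⟨hCσ0, hCσlo⟩, hCσhi⟩ := hCσ'
    refine oddCover_of_perSpin T.box _ _ T.LT (by exact_mod_cast hLT) ?_ ?_ ?_
    · intro p hp
      refine ⟨⟨Cσ.ℓ, Cσ.lo, Cσ.hi, Cσ.F.toFinset⟩, List.mem_map.mpr ⟨Cσ, hCσ, rfl⟩, hCσ0, ?_, ?_⟩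
      · exact le_trans (by exact_mod_cast hCσlo : ((Cσ.lo : ℚ) : ℝ) ≤ (T.σlo : ℝ)) hp.1.1
      · exact le_trans hp.1.2 (by exact_mod_cast hCσhi : (T.σhi : ℝ) ≤ ((Cσ.hi : ℚ) : ℝ))
    · intro Δ h3Δ hΔE
      obtain ⟨I, hI, h1, h2⟩ := chainCovers_sound _ _ _ h3 Δ (by exact_mod_cast h3Δ) hΔE.le
      obtain ⟨C, hC, hCℓ, rfl⟩ := T.exists_oddCell_of_mem_ivls hI
      exact ⟨⟨C.ℓ, C.lo, C.hi, C.F.toFinset⟩, List.mem_map.mpr ⟨C, hC, rfl⟩, hCℓ, h1, h2⟩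
    · intro ℓ h1ℓ hℓL Δ hbΔ hΔE
      have hch : chainCovers ((ℓ : ℚ) + 1) T.E_T (T.oddIvls ℓ) = true := by
        have h := hℓ ℓ (List.mem_range.mpr hℓL)
        rw [Bool.or_eq_true, decide_eq_true_iff] at h
        rcases h with h | h
        · omega
        · exact h
      obtain ⟨I, hI, h1, h2⟩ := chainCovers_sound _ _ _ hch Δ (by push_cast; exact hbΔ.le) hΔE.le
      obtain ⟨C, hC, hCℓ, rfl⟩ := T.exists_oddCell_of_mem_ivls hI
      exact ⟨⟨C.ℓ, C.lo, C.hi, C.F.toFinset⟩, List.mem_map.mpr ⟨C, hC, rfl⟩, hCℓ, h1, h2⟩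
  -- odd heads: the hypothesis (regularised: uses `b_ℓ < Δ`)
  · intro c hc p hp Δ ha hb hbΔ _ _
    obtain ⟨C, hC, rfl⟩ := List.mem_map.mp hc
    exact hOH C hC p hp Δ ha hb hbΔ
  -- off the odd head sets
  · intro c hc q hq hr
    obtain ⟨C, hC, rfl⟩ := List.mem_map.mp hc
    have hcell := hOcells C hC
    simp only [checkOddCellS, Bool.and_eq_true, decide_eq_true_eq, List.all_eq_true] at hcell
    obtain ⟨⟨⟨_, _⟩, _⟩, hcanon⟩ := hcell
    exact offHead_of_canonOK hcanon q hq hr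


/-! ### The structural check with the centred-form identity leaf check -/

/-- Power enclosures ∧ the identity kd-certificate checked with the CENTRED-FORM leaf check `identityLeafC`. [folklore] -/
def checkIdentityC : Bool :=
  T.κ.check (T.εlo - T.σhi) (T.εhi - T.σlo) && T.μσ.check (-(2 * T.σhi)) (-(2 * T.σlo)) &&
    T.με.check (-(2 * T.εhi)) (-(2 * T.εlo)) &&
    T.tI.check (identityLeafC T.c T.L) [(T.σlo, T.σhi), (T.εlo, T.εhi), (T.κ.lo, T.κ.hi)]

/-- `checkS` with `checkIdentityC` in place of `checkIdentity`. [folklore] -/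
def checkSC : Bool :=
  T.checkBasic && T.checkIdentityC && T.evenCells.all T.checkEvenCellS && T.checkEvenCover &&
    T.oddCells.all T.checkOddCellS && T.checkOddCover

/-- Assembly of `checkSC` from its six conjuncts (the pattern of `checkS_of_conjuncts`). [folklore] -/
theorem checkSC_of_conjuncts (hB : T.checkBasic = true) (hI : T.checkIdentityC = true)
    (hE : T.evenCells.all T.checkEvenCellS = true) (hEc : T.checkEvenCover = true)
    (hO : T.oddCells.all T.checkOddCellS = true) (hOc : T.checkOddCover = true) : T.checkSC = true := by
  simp only [checkSC, hB, hI, hE, hEc, hO, hOc, Bool.and_self]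

/-- **THE TABLE THEOREM (g2), centred-form identity route**: `checkSC` + both head layers + even region + odd cone ⇒ the box
is excluded. [cite: KosPolandSimmonsduffin2014, §3.3 eq. (3.16)] -/
theorem boxExcluded_of_taylorTable_headsC (h : T.checkSC = true) (hEH : T.EvenHeads) (hOH : T.OddHeads)
    (hR : TaylorEvenRegion T.α T.box ((T.E₀ : ℚ) : ℝ)) (hC : T.OddCone) : BoxExcluded T.box := by
  simp only [checkSC, Bool.and_eq_true] at h
  obtain ⟨⟨⟨⟨⟨hB, hI⟩, hEcells⟩, hEcov⟩, hOcells⟩, hOcov⟩ := h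
  simp only [checkIdentityC, Bool.and_eq_true] at hI
  obtain ⟨⟨⟨hκ, _⟩, _⟩, htI⟩ := hI
  have hB' := hB
  simp only [checkBasic, Bool.and_eq_true, decide_eq_true_eq] at hB'
  obtain ⟨⟨⟨⟨⟨⟨⟨⟨hL, _⟩, _⟩, _⟩, _⟩, _⟩, _⟩, _⟩, _⟩ := hB'
  obtain ⟨hκhi, hκr₁, hκr₂, hκ₁, hκ₂⟩ := PowEncl.check_spec hκ
  exact T.boxExcluded_of_taylorTable_heads_of_identityPos hB
    (identity_pos_of_kdCheckC T.c hL hκhi hκr₁ hκr₂ hκ₁ hκ₂ htI) hEcells hEcov hOcells hOcov hEH hOH hR hC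


/-! ### The odd-head certificate route (δ-merged finals) and the all-fast capstone under the centred identity check -/

/-- The three power-enclosure memberships from `checkIdentityC` (same conclusion as `scalars_mem_of_checkIdentity`, which reads
only these three conjuncts of `checkIdentity`). [folklore] -/
theorem scalars_mem_of_checkIdentityC (hI : T.checkIdentityC = true) (S : ℕ) :
    ∀ p ∈ T.box, MI.mem S ((1 / 2 : ℝ) ^ (p.2 - p.1)) (T.KI S) ∧ MI.mem S ((1 / 2 : ℝ) ^ (-(2 * p.1))) (T.MσI S) ∧
      MI.mem S ((1 / 2 : ℝ) ^ (-(2 * p.2))) (T.MεI S) := by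
  simp only [checkIdentityC, Bool.and_eq_true] at hI
  obtain ⟨⟨⟨hκ, hμσ⟩, hμε⟩, _⟩ := hI
  obtain ⟨hκhi, hκr₁, hκr₂, hκ₁, hκ₂⟩ := PowEncl.check_spec hκ
  obtain ⟨hμσhi, hμσr₁, hμσr₂, hμσ₁, hμσ₂⟩ := PowEncl.check_spec hμσ
  obtain ⟨hμεhi, hμεr₁, hμεr₂, hμε₁, hμε₂⟩ := PowEncl.check_spec hμε
  intro p hp
  obtain ⟨⟨hσ1, hσ2⟩, ⟨hε1, hε2⟩⟩ := hp
  have hr₁' : (T.κ.r₁ : ℝ) ≤ (T.εlo : ℝ) - (T.σhi : ℝ) := by exact_mod_cast hκr₁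
  have hr₂' : (T.εhi : ℝ) - (T.σlo : ℝ) ≤ (T.κ.r₂ : ℝ) := by exact_mod_cast hκr₂
  have hK := half_rpow_mem_of_checks hκhi hκ₁ hκ₂ (t := p.2 - p.1) (by linarith) (by linarith)
  have hu₁' : (T.μσ.r₁ : ℝ) ≤ -(2 * (T.σhi : ℝ)) := by exact_mod_cast hμσr₁
  have hu₂' : -(2 * (T.σlo : ℝ)) ≤ (T.μσ.r₂ : ℝ) := by exact_mod_cast hμσr₂
  have hMσ := half_rpow_mem_of_checks hμσhi hμσ₁ hμσ₂ (t := -(2 * p.1)) (by linarith) (by linarith)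
  have hv₁' : (T.με.r₁ : ℝ) ≤ -(2 * (T.εhi : ℝ)) := by exact_mod_cast hμεr₁
  have hv₂' : -(2 * (T.εlo : ℝ)) ≤ (T.με.r₂ : ℝ) := by exact_mod_cast hμεr₂
  have hMε := half_rpow_mem_of_checks hμεhi hμε₁ hμε₂ (t := -(2 * p.2)) (by linarith) (by linarith)
  exact ⟨HRTMAB.mem_ivlQ S hK.1 hK.2, HRTMAB.mem_ivlQ S hMσ.1 hMσ.2, HRTMAB.mem_ivlQ S hMε.1 hMε.2⟩

/-- **`OddHeads` from a δ-expanded FAST odd head certificate, merged final checks, with the scalar memberships as a HYPOTHESIS**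
(= `oddHeads_of_certΔM` with its one use of `checkIdentity` abstracted; serves both identity routes). [cite: KosPolandSimmonsduffin2014, §3.3 eq. (3.16)] -/
theorem oddHeads_of_certΔM_of_scalars (H : OddHeadCertΔ)
    (hsc : ∀ p ∈ T.box, MI.mem H.R.S ((1 / 2 : ℝ) ^ (p.2 - p.1)) (T.KI H.R.S) ∧ MI.mem H.R.S ((1 / 2 : ℝ) ^ (-(2 * p.1))) (T.MσI H.R.S) ∧
      MI.mem H.R.S ((1 / 2 : ℝ) ^ (-(2 * p.2))) (T.MεI H.R.S)) (hS : T.oddCells.all T.checkOddCellS = true)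
    (hm : T.oddMatchOKΔ H = true) (hV : H.R.ValidΔ T.c T.L T.ψ T.Lψ T.σlo T.σhi T.εlo T.εhi)
    (hparts : ∀ i k : ℕ, i < T.oddCells.length → k < H.numParts i → H.partOK i k = true)
    (hfinal : ∀ i : ℕ, i < T.oddCells.length → T.oddFinalOKM H i = true) : T.OddHeads := by
  intro C hC p hp Δ hlo hhi hbΔ
  obtain ⟨i, hi, hCi⟩ := List.getElem_of_mem hC
  simp only [oddMatchOKΔ, Bool.and_eq_true, decide_eq_true_eq, List.all_eq_true, List.mem_range] at hm
  obtain ⟨⟨⟨_, ht₁⟩, ht₂⟩, hall⟩ := hm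
  have hmi := hall i hi
  rw [List.getElem?_eq_getElem hi, hCi] at hmi
  obtain ⟨hℓ, hF, hlo', hhi', hℓlo⟩ := oddCellMatch_spec hmi
  rw [List.all_eq_true] at hS
  have hcell := hS C hC
  simp only [checkOddCellS, Bool.and_eq_true, decide_eq_true_eq, List.all_eq_true] at hcell
  obtain ⟨⟨⟨hFnd, hFj⟩, _⟩, _⟩ := hcell
  have hFnd' : (H.cellTM i).F.Nodup := by rw [hF]; exact hFnd
  have hFj' : ∀ q ∈ (H.cellTM i).F, q.2 ≤ (H.cellTM i).ℓ + q.1 := by rw [hF, hℓ]; exact fun q hq => hFj q hq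
  have hparts' : ∀ p' ∈ H.cellParts i, oddHeadPartOKΔ H.R (H.cellTM i) H.t₁ H.t₂ p' = true := by
    intro p' hp'
    obtain ⟨k, hk, hpk⟩ := List.getElem_of_mem hp'
    simpa only [OddHeadCertΔ.partOK, OddHeadCertΔ.part, List.getD_eq_getElem _ _ hk, hpk] using hparts i k hi hk
  have hlo'' : ((H.cellTM i).lo : ℝ) ≤ Δ := le_trans (by exact_mod_cast hlo') hlo
  have hhi'' : Δ ≤ ((H.cellTM i).hi : ℝ) := le_trans hhi (by exact_mod_cast hhi')
  have hbΔ' : unitarityBound3D (H.cellTM i).ℓ < Δ := by rw [hℓ]; exact hbΔ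
  have h := oddHead_nonneg_of_partsΔM T.c T.ψ hFnd' hFj' hℓlo hV ht₁ ht₂ (fun q hq => (hsc q hq).1)
    (fun q hq => (hsc q hq).2.1) (fun q hq => (hsc q hq).2.2) hparts' (hfinal i hi) p hp Δ hlo'' hhi'' hbΔ'
  rw [hF, hℓ] at h; exact h

/-- `OddHeads` from a δ-merged odd head certificate under the CENTRED identity check. [folklore] -/
theorem oddHeads_of_certΔM_C (H : OddHeadCertΔ) (hI : T.checkIdentityC = true) (hS : T.oddCells.all T.checkOddCellS = true)
    (hm : T.oddMatchOKΔ H = true) (hV : H.R.ValidΔ T.c T.L T.ψ T.Lψ T.σlo T.σhi T.εlo T.εhi)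
    (hparts : ∀ i k : ℕ, i < T.oddCells.length → k < H.numParts i → H.partOK i k = true)
    (hfinal : ∀ i : ℕ, i < T.oddCells.length → T.oddFinalOKM H i = true) : T.OddHeads :=
  T.oddHeads_of_certΔM_of_scalars H (T.scalars_mem_of_checkIdentityC hI H.R.S) hS hm hV hparts hfinal

/-- **ALL-FAST capstone, merged odd finals, CENTRED identity route**: `checkSC` + the two head certificates + the two region layers ⇒
the box is excluded (= `boxExcluded_of_taylorTable_certΔM` with `checkSC`). [cite: KosPolandSimmonsduffin2014, §3.3 eq. (3.16)] -/
theorem boxExcluded_of_taylorTable_certΔM_C (h : T.checkSC = true)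
    (HE : EvenHeadCertΔ) (hmE : T.evenMatchOKΔ HE = true) (hVE : HE.R.ValidΔ T.c T.L T.σlo T.σhi T.εlo T.εhi)
    (hpE : ∀ i k : ℕ, i < T.evenCells.length → k < HE.numParts i → HE.partOK i k = true)
    (hfE : ∀ i : ℕ, i < T.evenCells.length → HE.finalOK i = true)
    (HO : OddHeadCertΔ) (hmO : T.oddMatchOKΔ HO = true) (hVO : HO.R.ValidΔ T.c T.L T.ψ T.Lψ T.σlo T.σhi T.εlo T.εhi)
    (hpO : ∀ i k : ℕ, i < T.oddCells.length → k < HO.numParts i → HO.partOK i k = true)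
    (hfO : ∀ i : ℕ, i < T.oddCells.length → T.oddFinalOKM HO i = true)
    (hR : TaylorEvenRegion T.α T.box ((T.E₀ : ℚ) : ℝ)) (hC : T.OddCone) : BoxExcluded T.box := by
  have h' := h; simp only [checkSC, Bool.and_eq_true] at h'
  obtain ⟨⟨⟨⟨⟨_, hI⟩, hEcells⟩, _⟩, hOcells⟩, _⟩ := h'
  exact T.boxExcluded_of_taylorTable_headsC h (T.evenHeads_of_certΔ HE hEcells hmE hVE hpE hfE)
    (T.oddHeads_of_certΔM_C HO hI hOcells hmO hVO hpO hfO) hR hC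

end TaylorTable

end Summit.CriticalPhenomena.Ising3D
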